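import Literature.NumberTheory.EllipticCurves.SelmerLocalConditionUnramifiedTorsion
import Literature.NumberTheory.EllipticCurves.PadicPointsFiniteIndexProofs
import Mathlib.NumberTheory.Padics.HeightOneSpectrum
import HarnessLib

/-!
# A UNIFORM exponent at a finite place: `#E(K_v)_tors • c ∈ 𝓢_v(E)` for every `n ≠ 0` and every
# `c ∈ H¹(K, E[n])` unramified above `v` — unconditionally over `ℚ`

`Proofs`-style file (theorems only: no definition, no named fact, no `sorry`) in topic
`NumberTheory/EllipticCurves`, sequel of `SelmerLocalConditionUnramifiedTorsion.lean`
(`#E(K_v)[n] • c ∈ selmerLocalKer W K_v n` for `c` unramified at a prime above `v`).  Here the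
exponent is made INDEPENDENT of `n`: `#E(K_v)[n]` divides `#E(K_v)_tors`, which is finite — proved
below over `ℚ` from Silverman AEC Prop. VII.6.3 (`E(ℚ_ℓ)` has a finite-index subgroup `≅ ℤ_ℓ`, the
tree's `exists_finiteIndex_addEquiv_padicInt_holds`) transported along Mathlib's
`ℚ_v ≃ ℚ_ℓ` (`Rat.HeightOneSpectrum.adicCompletion.padicEquiv`), and taken as a hypothesis over a
general number field (AEC VII.6.3 for finite extensions of `ℚ_ℓ` is not in the tree).

The `ℚ`-statement `WeierstrassCurve.exists_nsmul_mem_selmerLocalKer_of_unramified` is the EXACT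
signature asked for by seat `bsd-cn100-s2-c3` (g9, cell bus 2026-08-27T01:10:58Z) as input (L2) of
the discharge of `Kato2004.locP_kernel_isTorsion_of_rankOne` (conjunct 11 of the citation-borne stub
of the `kato-zeta-perrin-riou` lines on stmt-BirchSwinnertonDyer-19080 / -19160; cell `bsd-cn100`,
this file by seat `bsd-cn100-transfer-2` g6).  Nothing about BSD is claimed.

## Results

* `WeierstrassCurve.finite_addTorsion_point_padic` — `E(ℚ_p)_tors` is finite (AEC VII.6.3 + `ℤ_p`
  torsion-free).
* `WeierstrassCurve.finite_addTorsion_point_adicCompletion_rat` — `E(ℚ_v)_tors` is finite for every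
  finite place `v` of `ℚ` (transport along `ℚ_v ≃ₐ[ℚ] ℚ_ℓ`).
* `WeierstrassCurve.exists_nsmul_mem_selmerLocalKer_of_unramified_of_finite` — over any number field
  `K`, at a place `v` with `E(K_v)_tors` finite: `∃ t ≠ 0, ∀ n ≠ 0, ∀ c` unramified at the primes
  above `v`, `t • c ∈ selmerLocalKer W K_v n` (`t = #E(K_v)_tors`).
* `WeierstrassCurve.exists_nsmul_mem_selmerLocalKer_of_unramified` — the same over `ℚ`,
  unconditionally.

## References

* [SilvermanAEC2009] J. H. Silverman, *AEC*, Prop. VII.6.3, Cor. III.6.4.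
* [MilneADT2006] J. S. Milne, *Arithmetic Duality Theorems*, Ch. I §2 Lemma 2.10, Prop. 3.8.
-/

noncomputable section

open scoped Classical Pointwise
open NumberField IsDedekindDomain Field
open Literature.NumberTheory.EllipticCurves Literature.NumberTheory.GaloisRepresentations

universe u

namespace WeierstrassCurve

/-! ## §1 Finiteness of `E(ℚ_ℓ)_tors` and of `E(ℚ_v)_tors` -/

/-- **`E(ℚ_p)_tors` is finite** (Silverman AEC Prop. VII.6.3: `E(ℚ_p) ⊇ A ≅ ℤ_p` of finite index;
`ℤ_p` is torsion-free, so the torsion subgroup injects into the finite quotient `E(ℚ_p)/A`).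
[cite: SilvermanAEC2009, Prop. VII.6.3] -/
theorem finite_addTorsion_point_padic {p : ℕ} [Fact p.Prime] (W : WeierstrassCurve ℚ_[p])
    [W.IsElliptic] : Finite (AddCommGroup.torsion W.toAffine.Point) := by
  obtain ⟨A, hA, ⟨e⟩⟩ := exists_finiteIndex_addEquiv_padicInt_holds p W
  haveI := hA
  -- the quotient map is injective on the torsion subgroup
  refine Finite.of_injective (fun x : AddCommGroup.torsion W.toAffine.Point =>
    (QuotientAddGroup.mk (x : W.toAffine.Point) : W.toAffine.Point ⧸ A)) fun x y hxy => ?_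
  have hmem : (x : W.toAffine.Point) - y ∈ A := by
    rw [← QuotientAddGroup.eq_iff_sub_mem]; exact hxy
  -- `x - y` is torsion and lies in `A ≅ ℤ_p`, hence is `0`
  have htor : IsOfFinAddOrder ((x : W.toAffine.Point) - y) :=
    (AddCommGroup.torsion W.toAffine.Point).sub_mem x.2 y.2
  obtain ⟨m, hm, hm0⟩ := (isOfFinAddOrder_iff_nsmul_eq_zero).mp htor
  have hz : m • e ⟨_, hmem⟩ = 0 := by
    rw [← map_nsmul, ← map_zero e]
    congr 1
    exact Subtype.ext (by simpa using hm0)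
  have hz' : e ⟨_, hmem⟩ = 0 := by
    rcases (smul_eq_zero.mp hz) with h | h
    · exact absurd h hm.ne'
    · exact h
  have h0 : (⟨_, hmem⟩ : A) = 0 := e.injective (by rw [hz', map_zero])
  exact Subtype.ext (sub_eq_zero.mp (congrArg Subtype.val h0))

/-- **`E(ℚ_v)_tors` is finite** for every finite place `v` of `ℚ`: transport of
`finite_addTorsion_point_padic` along Mathlib's `ℚ`-algebra isomorphism `ℚ_v ≃ ℚ_ℓ`
(`Rat.HeightOneSpectrum.adicCompletion.padicEquiv`), which induces an injective homomorphism on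
points carrying torsion to torsion. [cite: SilvermanAEC2009, Prop. VII.6.3] -/
theorem finite_addTorsion_point_adicCompletion_rat (W : WeierstrassCurve ℚ) [W.IsElliptic]
    (v : HeightOneSpectrum (𝓞 ℚ)) :
    Finite (AddCommGroup.torsion (W.baseChange (v.adicCompletion ℚ)).toAffine.Point) := by
  set ℓ : Nat.Primes := Rat.HeightOneSpectrum.primesEquiv (R := 𝓞 ℚ) v with hℓ
  haveI : Fact (ℓ : ℕ).Prime := ⟨ℓ.2⟩
  let e : v.adicCompletion ℚ →ₐ[ℚ] ℚ_[ℓ] :=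
    (Rat.HeightOneSpectrum.adicCompletion.padicEquiv (R := 𝓞 ℚ) v).toAlgEquiv.toAlgHom
  let f : (W.baseChange (v.adicCompletion ℚ)).toAffine.Point →+ (W.baseChange ℚ_[ℓ]).toAffine.Point :=
    Affine.Point.map e
  have hf : Function.Injective f := Affine.Point.map_injective (W' := W) e
  haveI : Finite (AddCommGroup.torsion (W.baseChange ℚ_[ℓ]).toAffine.Point) :=
    finite_addTorsion_point_padic (W.baseChange ℚ_[ℓ])
  refine Finite.of_injective (fun x : AddCommGroup.torsion (W.baseChange (v.adicCompletion ℚ)).toAffine.Point =>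
    (⟨f x, f.isOfFinAddOrder x.2⟩ : AddCommGroup.torsion (W.baseChange ℚ_[ℓ]).toAffine.Point))
    fun x y hxy => ?_
  exact Subtype.ext (hf (congrArg Subtype.val hxy))

/-! ## §2 The uniform exponent -/

variable {K : Type u} [Field K] [NumberField K]

/-- **Uniform exponent at a finite place, given `E(K_v)_tors` finite.**  For an elliptic curve
`E = W` over a number field `K` and a finite place `v` such that the torsion subgroup of `E(K_v)` is
finite, there is `t ≠ 0` (namely `t = #E(K_v)_tors`) such that for EVERY `n ≠ 0` and every
`c ∈ H¹(K, E[n])` unramified at the primes above `v`, `t • c ∈ selmerLocalKer W K_v n`.  Proof: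
`#E(K_v)[n] • c ∈ 𝓢_v` (`card_torsionPoints_nsmul_mem_selmerLocalKer_of_mem_unramifiedKer`, at any
one prime above `v`) and `#E(K_v)[n] ∣ #E(K_v)_tors`. [cite: MilneADT2006, Ch. I §2 Lemma 2.10]
[cite: SilvermanAEC2009, Prop. VII.6.3] -/
theorem exists_nsmul_mem_selmerLocalKer_of_unramified_of_finite (W : WeierstrassCurve K)
    [W.IsElliptic] (v : HeightOneSpectrum (𝓞 K))
    [Finite (AddCommGroup.torsion (W.baseChange (v.adicCompletion K)).toAffine.Point)] :
    ∃ t : ℕ, t ≠ 0 ∧ ∀ (n : ℤ), n ≠ 0 → ∀ c : galH1Torsion W n,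
      (∀ 𝔓 ∈ v.primesAbove, c ∈ unramifiedKer (geomTorsion W n) 𝔓) →
        t • c ∈ selmerLocalKer W (v.adicCompletion K) n := by
  refine ⟨Nat.card (AddCommGroup.torsion (W.baseChange (v.adicCompletion K)).toAffine.Point),
    Nat.card_pos.ne', fun n hn c hc => ?_⟩
  -- one prime above `v`
  obtain ⟨𝔐, h𝔐⟩ := v.localPrimesAbove_nonempty
  have h𝔓 := HeightOneSpectrum.primeBelow_mem_primesAbove
    (ι := closureEmb (K := K) (v.adicCompletion K)) h𝔐
  have hmem := W.card_torsionPoints_nsmul_mem_selmerLocalKer_of_mem_unramifiedKer hn h𝔓 (hc _ h𝔓)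
  -- `E(K_v)[n] ≤ E(K_v)_tors`
  have hle : torsionPoints W (v.adicCompletion K) n ≤
      AddCommGroup.torsion (W.baseChange (v.adicCompletion K)).toAffine.Point := by
    intro P hP
    have hP' : n • P = 0 := (Submodule.mem_torsionBy_iff _ _).mp hP
    exact isOfFinAddOrder_iff_zsmul_eq_zero.mpr ⟨n, hn, hP'⟩
  obtain ⟨d, hd⟩ := AddSubgroup.card_dvd_of_le hle
  rw [hd, mul_nsmul]
  exact AddSubgroup.nsmul_mem _ hmem d

/-- **Uniform exponent at a finite place of `ℚ`, unconditionally** (the signature consumed by the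
discharge of `Kato2004.locP_kernel_isTorsion_of_rankOne`): for an elliptic curve `E = W` over `ℚ` and
a finite place `v` there is `t ≠ 0` with `t • c ∈ selmerLocalKer W ℚ_v n` for EVERY `n ≠ 0` and every
`c ∈ H¹(ℚ, E[n])` unramified at the primes above `v`.  (`t = #E(ℚ_v)_tors`, finite by
`finite_addTorsion_point_adicCompletion_rat`.) [cite: MilneADT2006, Ch. I §2 Lemma 2.10]
[cite: SilvermanAEC2009, Prop. VII.6.3] -/
theorem exists_nsmul_mem_selmerLocalKer_of_unramified (W : WeierstrassCurve ℚ) [W.IsElliptic]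
    (v : HeightOneSpectrum (𝓞 ℚ)) :
    ∃ t : ℕ, t ≠ 0 ∧ ∀ (n : ℤ), n ≠ 0 → ∀ c : galH1Torsion W n,
      (∀ 𝔓 ∈ v.primesAbove, c ∈ unramifiedKer (geomTorsion W n) 𝔓) →
        t • c ∈ selmerLocalKer W (v.adicCompletion ℚ) n := by
  haveI := W.finite_addTorsion_point_adicCompletion_rat v
  exact W.exists_nsmul_mem_selmerLocalKer_of_unramified_of_finite v

end WeierstrassCurve

end
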